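import Summits.KontsevichZagierPeriods.KontsevichZagierPeriods.Theorems.RootDecompWalshStrataConicSector
import Summits.KontsevichZagierPeriods.KontsevichZagierPeriods.Theorems.RootDecompWalshStrataPolarChart04

/-!
# Root decomposition & Walsh strata — E-type assembly I: walls and the conic-wall condition under the plane moves (gen 9, §40)

Route `RootDecompWalshStrata`, leaf `QuadricBakerDescent` (stmt-27597), residual R-E2 = the E-type ASSEMBLY
(NODE.md, decomp-kz-lens-4, GEN 9 MENU (1)).  Bookkeeping for gluing the sector theorem
`InBaker.of_psector_cwalls` (§39) over the four moves `swap`, `negX`, `negY`, `dil` and the Lagrange map: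
how rational affine forms (`Wall`) transform, the radicand `erad = a(κ₀X² + κ₁Y²) + c` of the elliptic
weight, and the set `goodWalls` of adapted conic walls `erad = q²` meeting the strata conditions of §39 in BOTH
orientations (so that the condition is invariant under the moves: `goodWalls_swap/negX/negY/scale`).
[KontsevichZagier2001 §1.2 rule (2); this node]
-/

noncomputable section

open Set MeasureTheory MvPolynomial Literature.NumberTheory.Transcendental
open Literature.ModelTheory.ExponentialFields (IsSemialgebraic)

namespace Summit.KontsevichZagierPeriods.RootDecompWalshStrata.ConicDescent.BallCube

variable {κ₀ κ₁ : ℚ}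

/-! #### 40.1 Walls under the moves of the plane -/

namespace Wall

variable (ℓ : Wall)

/-- The form in swapped coordinates `(X, Y) ↦ (Y, X)`. -/
def swap : Wall := ⟨ℓ.k0, ℓ.k2, ℓ.k1⟩
/-- The form in the coordinates reflected by `X ↦ −X`. -/
def negX : Wall := ⟨ℓ.k0, -ℓ.k1, ℓ.k2⟩
/-- The form in the coordinates reflected by `Y ↦ −Y`. -/
def negY : Wall := ⟨ℓ.k0, ℓ.k1, -ℓ.k2⟩
/-- The form in the coordinates dilated by `1/t`: linear part scaled by `t`. -/
def scale (t : ℚ) : Wall := ⟨ℓ.k0, ℓ.k1 * t, ℓ.k2 * t⟩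
/-- Precomposition with a rational affine map: `(ℓ.precomp N)(w) = ℓ(N w)`. -/
def precomp (N : AffMap) : Wall :=
  ⟨ℓ.k0 + ℓ.k1 * N.c0 + ℓ.k2 * N.c1, ℓ.k1 * N.m00 + ℓ.k2 * N.m10, ℓ.k1 * N.m01 + ℓ.k2 * N.m11⟩

/-- Auxiliary step `swap_k0`. [bookkeeping] -/
@[simp] theorem swap_k0 : ℓ.swap.k0 = ℓ.k0 := rfl
/-- Auxiliary step `swap_k1`. [bookkeeping] -/
@[simp] theorem swap_k1 : ℓ.swap.k1 = ℓ.k2 := rfl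
/-- Auxiliary step `swap_k2`. [bookkeeping] -/
@[simp] theorem swap_k2 : ℓ.swap.k2 = ℓ.k1 := rfl
/-- Auxiliary step `negX_k0`. [bookkeeping] -/
@[simp] theorem negX_k0 : ℓ.negX.k0 = ℓ.k0 := rfl
/-- Auxiliary step `negX_k1`. [bookkeeping] -/
@[simp] theorem negX_k1 : ℓ.negX.k1 = -ℓ.k1 := rfl
/-- Auxiliary step `negX_k2`. [bookkeeping] -/
@[simp] theorem negX_k2 : ℓ.negX.k2 = ℓ.k2 := rfl
/-- Auxiliary step `negY_k0`. [bookkeeping] -/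
@[simp] theorem negY_k0 : ℓ.negY.k0 = ℓ.k0 := rfl
/-- Auxiliary step `negY_k1`. [bookkeeping] -/
@[simp] theorem negY_k1 : ℓ.negY.k1 = ℓ.k1 := rfl
/-- Auxiliary step `negY_k2`. [bookkeeping] -/
@[simp] theorem negY_k2 : ℓ.negY.k2 = -ℓ.k2 := rfl
/-- Auxiliary step `scale_k0`. [bookkeeping] -/
@[simp] theorem scale_k0 (t : ℚ) : (ℓ.scale t).k0 = ℓ.k0 := rfl
/-- Auxiliary step `scale_k1`. [bookkeeping] -/
@[simp] theorem scale_k1 (t : ℚ) : (ℓ.scale t).k1 = ℓ.k1 * t := rfl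
/-- Auxiliary step `scale_k2`. [bookkeeping] -/
@[simp] theorem scale_k2 (t : ℚ) : (ℓ.scale t).k2 = ℓ.k2 * t := rfl
/-- Auxiliary step `swap_swap`. [bookkeeping] -/
@[simp] theorem swap_swap : ℓ.swap.swap = ℓ := rfl

/-- Auxiliary step `swap_eval`. [bookkeeping] -/
theorem swap_eval (p : Fin 2 → ℝ) :
    ℓ.swap.eval (AffMap.swap.toFun p 0) (AffMap.swap.toFun p 1) = ℓ.eval (p 0) (p 1) := by
  simp only [swap, eval, AffMap.swap_toFun_zero, AffMap.swap_toFun_one]; ring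

/-- Auxiliary step `negX_eval`. [bookkeeping] -/
theorem negX_eval (p : Fin 2 → ℝ) :
    ℓ.negX.eval (AffMap.negX.toFun p 0) (AffMap.negX.toFun p 1) = ℓ.eval (p 0) (p 1) := by
  simp only [negX, eval, AffMap.negX_toFun_zero, AffMap.negX_toFun_one]; push_cast; ring

/-- Auxiliary step `negY_eval`. [bookkeeping] -/
theorem negY_eval (p : Fin 2 → ℝ) :
    ℓ.negY.eval (AffMap.negY.toFun p 0) (AffMap.negY.toFun p 1) = ℓ.eval (p 0) (p 1) := by
  simp only [negY, eval, AffMap.negY_toFun_zero, AffMap.negY_toFun_one]; push_cast; ring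

/-- Auxiliary step `scale_eval`. [bookkeeping] -/
theorem scale_eval (t l : ℚ) (htl : t * l = 1) (p : Fin 2 → ℝ) :
    (ℓ.scale t).eval ((AffMap.dil l).toFun p 0) ((AffMap.dil l).toFun p 1) = ℓ.eval (p 0) (p 1) := by
  have h : (t : ℝ) * l = 1 := by exact_mod_cast htl
  simp only [scale, eval, AffMap.dil_toFun_zero, AffMap.dil_toFun_one]; push_cast
  linear_combination ((ℓ.k1 : ℝ) * p 0 + ℓ.k2 * p 1) * h

/-- Auxiliary step `precomp_eval`. [bookkeeping] -/
theorem precomp_eval (N : AffMap) (w : Fin 2 → ℝ) :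
    (ℓ.precomp N).eval (w 0) (w 1) = ℓ.eval (N.toFun w 0) (N.toFun w 1) := by
  simp only [precomp, eval, AffMap.toFun_zero, AffMap.toFun_one]; push_cast; ring

/-- A genuine form (`(k₁, k₂) ≠ 0`) stays genuine under the moves. [folklore] -/
theorem swap_gen (h : ℓ.k1 ≠ 0 ∨ ℓ.k2 ≠ 0) : ℓ.swap.k1 ≠ 0 ∨ ℓ.swap.k2 ≠ 0 := h.symm
/-- Auxiliary step `negX_gen`. [bookkeeping] -/
theorem negX_gen (h : ℓ.k1 ≠ 0 ∨ ℓ.k2 ≠ 0) : ℓ.negX.k1 ≠ 0 ∨ ℓ.negX.k2 ≠ 0 :=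
  h.imp (fun h1 => neg_ne_zero.2 h1) id
/-- Auxiliary step `negY_gen`. [bookkeeping] -/
theorem negY_gen (h : ℓ.k1 ≠ 0 ∨ ℓ.k2 ≠ 0) : ℓ.negY.k1 ≠ 0 ∨ ℓ.negY.k2 ≠ 0 :=
  h.imp id fun h2 => neg_ne_zero.2 h2
/-- Auxiliary step `scale_gen`. [bookkeeping] -/
theorem scale_gen {t : ℚ} (ht : t ≠ 0) (h : ℓ.k1 ≠ 0 ∨ ℓ.k2 ≠ 0) :
    (ℓ.scale t).k1 ≠ 0 ∨ (ℓ.scale t).k2 ≠ 0 :=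
  h.imp (fun h1 => mul_ne_zero h1 ht) fun h2 => mul_ne_zero h2 ht
/-- Auxiliary step `precomp_gen`. [bookkeeping] -/
theorem precomp_gen {N : AffMap} (hN : N.det ≠ 0) (h : ℓ.k1 ≠ 0 ∨ ℓ.k2 ≠ 0) :
    (ℓ.precomp N).k1 ≠ 0 ∨ (ℓ.precomp N).k2 ≠ 0 := by
  by_contra hc
  simp only [not_or, not_not, precomp] at hc
  obtain ⟨h1, h2⟩ := hc
  have e1 : ℓ.k1 * N.det = N.m11 * (ℓ.k1 * N.m00 + ℓ.k2 * N.m10) - N.m10 * (ℓ.k1 * N.m01 + ℓ.k2 * N.m11) := by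
    simp only [AffMap.det]; ring
  have e2 : ℓ.k2 * N.det = N.m00 * (ℓ.k1 * N.m01 + ℓ.k2 * N.m11) - N.m01 * (ℓ.k1 * N.m00 + ℓ.k2 * N.m10) := by
    simp only [AffMap.det]; ring
  rw [h1, h2, mul_zero, mul_zero, sub_zero] at e1 e2
  rcases h with h | h
  · exact h ((mul_eq_zero.1 e1).resolve_right hN)
  · exact h ((mul_eq_zero.1 e2).resolve_right hN)

end Wall

/-! #### 40.2 The radicand, the conic-wall condition, invariance under the moves -/

/-- The radicand `a(κ₀X² + κ₁Y²) + c` of the elliptic weight `ellW`. -/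
def erad (κ₀ κ₁ a c : ℚ) (w : Fin 2 → ℝ) : ℝ := (a : ℝ) * (κ₀ * w 0 ^ 2 + κ₁ * w 1 ^ 2) + c

/-- Auxiliary step `ellW_eq_erad`. [bookkeeping] -/
theorem ellW_eq_erad (κ₀ κ₁ γ a c : ℚ) (w : Fin 2 → ℝ) :
    ellW κ₀ κ₁ γ a c w = (γ : ℝ) * √(erad κ₀ κ₁ a c w) := rfl

/-- Auxiliary step `erad_swap`. [bookkeeping] -/
theorem erad_swap (κ₀ κ₁ a c : ℚ) (p : Fin 2 → ℝ) :
    erad κ₁ κ₀ a c (AffMap.swap.toFun p) = erad κ₀ κ₁ a c p := by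
  simp only [erad, AffMap.swap_toFun_zero, AffMap.swap_toFun_one]; ring

/-- Auxiliary step `erad_negX`. [bookkeeping] -/
theorem erad_negX (κ₀ κ₁ a c : ℚ) (p : Fin 2 → ℝ) :
    erad κ₀ κ₁ a c (AffMap.negX.toFun p) = erad κ₀ κ₁ a c p := by
  simp only [erad, AffMap.negX_toFun_zero, AffMap.negX_toFun_one, neg_sq]

/-- Auxiliary step `erad_negY`. [bookkeeping] -/
theorem erad_negY (κ₀ κ₁ a c : ℚ) (p : Fin 2 → ℝ) :
    erad κ₀ κ₁ a c (AffMap.negY.toFun p) = erad κ₀ κ₁ a c p := by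
  simp only [erad, AffMap.negY_toFun_zero, AffMap.negY_toFun_one, neg_sq]

/-- Under the dilation by `l = 1/t` the radicand with `a` becomes the radicand with `at²`. [bookkeeping] -/
theorem erad_dil (κ₀ κ₁ a c t l : ℚ) (htl : t * l = 1) (p : Fin 2 → ℝ) :
    erad κ₀ κ₁ (a * t ^ 2) c ((AffMap.dil l).toFun p) = erad κ₀ κ₁ a c p := by
  have h : (t : ℝ) * l = 1 := by exact_mod_cast htl
  simp only [erad, AffMap.dil_toFun_zero, AffMap.dil_toFun_one]; push_cast
  linear_combination ((a : ℝ) * (κ₀ * p 0 ^ 2 + κ₁ * p 1 ^ 2) * ((t : ℝ) * l + 1)) * h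

/-- NON-DEGENERATE adapted conic walls: if the radicand `δ = eY² + fY + g` of the branches is a genuine
quadratic, it has no double root (the `hh` hypothesis of §§37–39). -/
def ndWall : Set ConicWall := {W | W.δe ≠ 0 → W.δg - W.δf ^ 2 / (4 * W.δe) ≠ 0}

/-- Auxiliary step `mem_ndWall`. [bookkeeping] -/
theorem mem_ndWall (W : ConicWall) : W ∈ ndWall ↔ (W.δe ≠ 0 → W.δg - W.δf ^ 2 / (4 * W.δe) ≠ 0) := Iff.rfl

/-- `ndWall` only depends on `(δe, δf², δg)` up to the weights of a rescaling. [bookkeeping] -/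
theorem ndWall_transfer {W W' : ConicWall} (u v : ℚ) (hu : u ≠ 0) (hv : v ≠ 0) (h1 : W'.δe = u * W.δe)
    (h2 : W'.δf ^ 2 = u * v * W.δf ^ 2) (h3 : W'.δg = v * W.δg) (h : W ∈ ndWall) : W' ∈ ndWall := by
  intro he'
  have he : W.δe ≠ 0 := fun h0 => he' (by rw [h1, h0, mul_zero])
  have key : W'.δg - W'.δf ^ 2 / (4 * W'.δe) = v * (W.δg - W.δf ^ 2 / (4 * W.δe)) := by
    rw [h1, h3, show W'.δf ^ 2 / (4 * (u * W.δe)) = v * (W.δf ^ 2 / (4 * W.δe)) by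
      rw [h2]; field_simp]
    ring
  rw [key]
  exact mul_ne_zero hv (h he)

/-- The GOOD CONIC WALLS `erad = q²` of an E-type piece, in a form invariant under the four moves: not the
degenerate parallel pair in either orientation, and — unless `c < 0` — off the centre (`q₀² ≠ c`) with
non-degenerate branch radicands in both orientations (the hypotheses `hq`, `hc` of
`InBaker.of_psector_cwalls` for `q` and for `q.swap`). -/
def goodWalls (κ₀ κ₁ a c : ℚ) : Set Wall :=
  {q | (a * κ₀ - q.k1 ^ 2 ≠ 0 ∨ q.k0 ≠ 0 ∨ q.k2 ≠ 0) ∧ (a * κ₁ - q.k2 ^ 2 ≠ 0 ∨ q.k0 ≠ 0 ∨ q.k1 ≠ 0) ∧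
    (c < 0 ∨ (q.k0 ^ 2 ≠ c ∧ cwall κ₀ κ₁ a c q ∈ ndWall ∧ cwall κ₁ κ₀ a c q.swap ∈ ndWall))}

section goodWalls

variable {a c : ℚ} {q : Wall}

/-- Auxiliary step `mem_goodWalls`. [bookkeeping] -/
theorem mem_goodWalls : q ∈ goodWalls κ₀ κ₁ a c ↔
    (a * κ₀ - q.k1 ^ 2 ≠ 0 ∨ q.k0 ≠ 0 ∨ q.k2 ≠ 0) ∧ (a * κ₁ - q.k2 ^ 2 ≠ 0 ∨ q.k0 ≠ 0 ∨ q.k1 ≠ 0) ∧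
      (c < 0 ∨ (q.k0 ^ 2 ≠ c ∧ cwall κ₀ κ₁ a c q ∈ ndWall ∧ cwall κ₁ κ₀ a c q.swap ∈ ndWall)) := Iff.rfl

/-- Auxiliary step `goodWalls_swap`. [bookkeeping] -/
theorem goodWalls_swap (h : q ∈ goodWalls κ₀ κ₁ a c) : q.swap ∈ goodWalls κ₁ κ₀ a c :=
  ⟨h.2.1, h.1, h.2.2.imp_right fun h3 => ⟨h3.1, h3.2.2, h3.2.1⟩⟩

/-- Auxiliary step `goodWalls_negX`. [bookkeeping] -/
theorem goodWalls_negX (h : q ∈ goodWalls κ₀ κ₁ a c) : q.negX ∈ goodWalls κ₀ κ₁ a c := by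
  refine ⟨?_, ?_, h.2.2.imp_right fun h3 => ⟨h3.1, ?_, ?_⟩⟩
  · simpa only [Wall.negX_k1, Wall.negX_k0, Wall.negX_k2, neg_sq, neg_ne_zero] using h.1
  · simpa only [Wall.negX_k1, Wall.negX_k0, Wall.negX_k2, neg_ne_zero] using h.2.1
  · exact ndWall_transfer 1 1 one_ne_zero one_ne_zero
      (by simp only [ConicWall.δe, ConicWall.k, cwall, Wall.negX]; ring)
      (by simp only [ConicWall.δf, cwall, Wall.negX]; ring)
      (by simp only [ConicWall.δg, ConicWall.k, cwall, Wall.negX]; ring) h3.2.1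
  · exact ndWall_transfer 1 1 one_ne_zero one_ne_zero
      (by simp only [ConicWall.δe, ConicWall.k, cwall, Wall.negX, Wall.swap]; ring)
      (by simp only [ConicWall.δf, cwall, Wall.negX, Wall.swap]; ring)
      (by simp only [ConicWall.δg, ConicWall.k, cwall, Wall.negX, Wall.swap]; ring) h3.2.2

/-- Auxiliary step `goodWalls_negY`. [bookkeeping] -/
theorem goodWalls_negY (h : q ∈ goodWalls κ₀ κ₁ a c) : q.negY ∈ goodWalls κ₀ κ₁ a c := by
  refine ⟨?_, ?_, h.2.2.imp_right fun h3 => ⟨h3.1, ?_, ?_⟩⟩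
  · simpa only [Wall.negY_k1, Wall.negY_k0, Wall.negY_k2, neg_ne_zero] using h.1
  · simpa only [Wall.negY_k1, Wall.negY_k0, Wall.negY_k2, neg_sq, neg_ne_zero] using h.2.1
  · exact ndWall_transfer 1 1 one_ne_zero one_ne_zero
      (by simp only [ConicWall.δe, ConicWall.k, cwall, Wall.negY]; ring)
      (by simp only [ConicWall.δf, cwall, Wall.negY]; ring)
      (by simp only [ConicWall.δg, ConicWall.k, cwall, Wall.negY]; ring) h3.2.1
  · exact ndWall_transfer 1 1 one_ne_zero one_ne_zero
      (by simp only [ConicWall.δe, ConicWall.k, cwall, Wall.negY, Wall.swap]; ring)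
      (by simp only [ConicWall.δf, cwall, Wall.negY, Wall.swap]; ring)
      (by simp only [ConicWall.δg, ConicWall.k, cwall, Wall.negY, Wall.swap]; ring) h3.2.2

/-- Auxiliary step `goodWalls_scale`. [bookkeeping] -/
theorem goodWalls_scale {t : ℚ} (ht : t ≠ 0) (h : q ∈ goodWalls κ₀ κ₁ a c) :
    q.scale t ∈ goodWalls κ₀ κ₁ (a * t ^ 2) c := by
  have ht2 : t ^ 2 ≠ 0 := pow_ne_zero 2 ht
  have ht4 : t ^ 4 ≠ 0 := pow_ne_zero 4 ht
  refine ⟨?_, ?_, h.2.2.imp_right fun h3 => ⟨h3.1, ?_, ?_⟩⟩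
  · refine h.1.imp (fun h1 => ?_) fun h1 => h1.imp id fun h2 => mul_ne_zero h2 ht
    rw [Wall.scale_k1, show a * t ^ 2 * κ₀ - (q.k1 * t) ^ 2 = t ^ 2 * (a * κ₀ - q.k1 ^ 2) by ring]
    exact mul_ne_zero ht2 h1
  · refine h.2.1.imp (fun h1 => ?_) fun h1 => h1.imp id fun h2 => mul_ne_zero h2 ht
    rw [Wall.scale_k2, show a * t ^ 2 * κ₁ - (q.k2 * t) ^ 2 = t ^ 2 * (a * κ₁ - q.k2 ^ 2) by ring]
    exact mul_ne_zero ht2 h1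
  · exact ndWall_transfer (t ^ 4) (t ^ 2) ht4 ht2
      (by simp only [ConicWall.δe, ConicWall.k, cwall, Wall.scale]; ring)
      (by simp only [ConicWall.δf, cwall, Wall.scale]; ring)
      (by simp only [ConicWall.δg, ConicWall.k, cwall, Wall.scale]; ring) h3.2.1
  · exact ndWall_transfer (t ^ 4) (t ^ 2) ht4 ht2
      (by simp only [ConicWall.δe, ConicWall.k, cwall, Wall.scale, Wall.swap]; ring)
      (by simp only [ConicWall.δf, cwall, Wall.scale, Wall.swap]; ring)
      (by simp only [ConicWall.δg, ConicWall.k, cwall, Wall.scale, Wall.swap]; ring) h3.2.2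

/-- The hypothesis `hq` of `InBaker.of_psector_cwalls` out of `goodWalls`. [bookkeeping] -/
theorem goodWalls_hq (h : q ∈ goodWalls κ₀ κ₁ a c) : a * κ₀ - q.k1 ^ 2 ≠ 0 ∨ q.k0 ≠ 0 ∨ q.k2 ≠ 0 := h.1

/-- The hypothesis `hc` of `InBaker.of_psector_cwalls` out of `goodWalls` (for `c ≥ 0`). [bookkeeping] -/
theorem goodWalls_hc (h : q ∈ goodWalls κ₀ κ₁ a c) (hc : ¬c < 0) :
    q.k0 ^ 2 ≠ c ∧ ((cwall κ₀ κ₁ a c q).δe ≠ 0 →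
      (cwall κ₀ κ₁ a c q).δg - (cwall κ₀ κ₁ a c q).δf ^ 2 / (4 * (cwall κ₀ κ₁ a c q).δe) ≠ 0) :=
  (h.2.2.resolve_left hc).imp_right fun h' => h'.1

end goodWalls

end Summit.KontsevichZagierPeriods.RootDecompWalshStrata.ConicDescent.BallCube

end
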